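import Summits.BirchSwinnertonDyer.BirchSwinnertonDyer.Theses.ErratumRoadFive
import Summits.BirchSwinnertonDyer.Rank1Residual.GaloisImage.LocalEulerPoincareCharacteristicHolds
import Literature.NumberTheory.GaloisRepresentations.NumberFieldCdTwoProofs
import HarnessLib

/-!
# Route `ErratumRoadFive` (rung K2), support item 19283 `PublishedInputsIMCReduction`: THREE of its sixteen conjuncts are REDUNDANT —
# conjunct 12 (Poitou–Tate reciprocity half) follows from conjunct 13, and conjuncts 15 (local Euler–Poincaré characteristic) and 16
# (`cd_p ≤ 2` for number fields) are THEOREMS of the tree (cell `bsd-stepL`, seat `bsd-stepL-imc-p1` g16; `--supports stmt-BirchSwinnertonDyer-19283`)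

This module imports the route file (its conclusion IS the route decl, by name), so no `_holds` link can be stated here.

## What this file proves

`publishedInputsIMCReduction_of_thirteen` — `PublishedInputsIMCReduction` (item 19283, the sixteen-conjunct published ∕ cited bundle bound by
`closes` as `hF`) from THIRTEEN of its conjuncts: conjunct 12 `poitouTate_sum_localTatePairing_eq_zero K` is derived from conjunct 13
`poitouTate_selmerStructure_duality K` (`poitouTate_sum_localTatePairing_eq_zero_of_selmerStructure_duality`); conjunct 15
`localEulerPoincareCharacteristic (K_v)` is the tree theorem `localEulerPoincareCharacteristic_holds` (Milne ADT I 2.8, in-kernel); conjunct 16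
`fieldCdLE_two_of_numberField` is the tree theorem `fieldCdLE_two_of_numberField_holds`. Bookkeeping for the planner (a restate of 19283 to the
thirteen-conjunct bundle is certified by this term); nothing booked.

HONEST FRAMING: theorem only (no definition, no named fact, no `sorry`); CONDITIONAL on the thirteen remaining published ∕ cited facts as
hypotheses; BSD is proved for no pair; no census word, tier or label moves (T7).
-/

set_option autoImplicit false
-- the Theorems namespace of this sub repeats the summit name by design (D-0017 nested layout)
set_option linter.dupNamespace false

noncomputable section

open NumberField IsDedekindDomain
open Literature.NumberTheory.EllipticCurves Literature.NumberTheory.EllipticCurves.ModularForms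
  Literature.NumberTheory.GaloisCohomology Literature.NumberTheory.GaloisRepresentations
open Summit.BirchSwinnertonDyer.BirchSwinnertonDyer.Theses.ErratumRoadFive

namespace Summit.BirchSwinnertonDyer.BirchSwinnertonDyer.Theorems

/-- **Support item 19283 `PublishedInputsIMCReduction` from THIRTEEN of its sixteen conjuncts** (12 ⟸ 13; 15, 16 are tree theorems).
CONDITIONAL on the thirteen; nothing booked. [cite: MilneADT2006, Ch. I, Thm. 4.10 and Thm. 2.8] -/
theorem publishedInputsIMCReduction_of_thirteen
    (h1 : GrossZagier1986_thm_I_7_3) (h2 : rank_eq_analyticRank_of_analyticRank_le_one)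
    (h3 : Skinner2016.thmC_padicValRat_bsd_rank_zero) (h4 : exists_isNewformOf)
    (h5 : CaiShuTian2014.thm11_trivialChar) (h6 : friedbergHoffstein_exists_twist_ne_zero_ramifiedAt)
    (h7 : mazur_not_dvd_maninConstant_of_odd)
    (h8 : ∀ (N : ℕ) [NeZero N] (W : WeierstrassCurve ℚ) (K : Type) [Field K] [NumberField K], gross_zagier N W K)
    (h9 : ∀ (N : ℕ) [NeZero N] (W : WeierstrassCurve ℚ) (K : Type) [Field K] [NumberField K], kolyvagin N W K)
    (h10 : ∀ (N : ℕ) [NeZero N] (W : WeierstrassCurve ℚ) (K : Type) [Field K] [NumberField K],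
      Kolyvagin1990_padicValNat_card_sha_le N W K)
    (h11 : HoffsteinLuo1997_exists_twist_L_one_ne_zero)
    (h13 : ∀ (K : Type) [Field K] [NumberField K], poitouTate_selmerStructure_duality K)
    (h14 : ∀ (K : Type) [Field K] [NumberField K], poitouTate_sha_tateDual K) : PublishedInputsIMCReduction := by
  refine ⟨h1, h2, h3, h4, h5, h6, h7, h8, h9, h10, h11,
    fun K _ _ ↦ poitouTate_sum_localTatePairing_eq_zero_of_selmerStructure_duality (h13 K), h13, h14, ?_,
    fieldCdLE_two_of_numberField_holds⟩
  intro K _ _ v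
  haveI : CharZero (v.adicCompletion K) := charZero_of_injective_algebraMap (algebraMap K _).injective
  exact localEulerPoincareCharacteristic_holds (v.adicCompletion K)

end Summit.BirchSwinnertonDyer.BirchSwinnertonDyer.Theorems

end
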